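import Summits.AtomisticToContinuum.Crystallization.Theorems.FrustratedLawDichotomyStrainedPatchHomValueT2SoundM

/-!
# (I1) part N — the THIRD-DERIVATIVE TABLES of the second/third-edition value leaf enclose the real data (roadmap for `valueLeafT2J_sound`, step 1):
# ★ `mem_alpha1LJHull` (`α′_LJ·ρ = 80u⁵ − 224u⁸`, `u = ρ⁻²`, endpoint hull), ★ `coefL_lip` (a Lipschitz-class label lies in ONE open regime, with
# `α ∈ co.al`, `β ∈ co.be`, `α′/ρ ∈ co.a1` and the derivative chain `β′ = αρ`, `α′ = (α′/ρ)·ρ` of the TRUE coefficient functions), ★ `mem_pt_rt`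
# (`P_ab = (α′/ρ)ζ_aζ_b + αν_ab`, `R_ab = αν_ab`), ★ `mem_omg` (`ω_abm`), ★★ `mem_thirdOf` (`T_abm = ζ_m P_ab + R_am ζ_b + R_bm ζ_a + β ω_abm`)
# (27623 `(H) HomFloor`, hcp half; decomp-a2c hand-1 g49; critic row 1674 (B) (I1) docket, item `valueLeafT2J_sound`).

No definitions (the real `ω_abm` is written out as the component sum `Σ_c [(∂_b y)_c (∂_m∂_a y)_c + (∂_a y)_c (∂_m∂_b y)_c + (∂_m y)_c (∂_a∂_b y)_c]` in the
folded coordinates `dyR / ddyR` of `…SoundJ`); 0 sorry; standard axioms; no instances / notation / `#eval`.  `--supports stmt-AtomisticToContinuum-27623`.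
-/

noncomputable section

namespace Summit.AtomisticToContinuum.Crystallization.Theorems.FrustratedLawDichotomyStrainedPatchHomValueT2Kit

open scoped BigOperators RealInnerProductSpace
open Finset
open Literature.Analysis.ValidatedNumerics.Numerics
open Summit.AtomisticToContinuum.Crystallization.Theorems.ChargedEnergyGapNegative (E3)
open Summit.AtomisticToContinuum.Crystallization.Theorems.FrustratedLawDichotomySchurCut (effPot w₄₅ ω₄)
open Summit.AtomisticToContinuum.Crystallization.Theorems.FrustratedLawDichotomyStrainedPatchTaylorLeaves (junctions)
open Summit.AtomisticToContinuum.Crystallization.Theorems.FrustratedLawDichotomyStrainedPatchHomCurvCoeff (wFI mem_wFI rhoFI mem_rhoFI)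
open Summit.AtomisticToContinuum.Crystallization.Theorems.FrustratedLawDichotomyStrainedPatchHomCurvCoeff3
  (ljTripleFI mem_ljTripleFI bumpWT1FI mem_bumpWT1FI k75 mem_k75 inv_sq_pow)
open Summit.AtomisticToContinuum.Crystallization.Theorems.FrustratedLawDichotomyStrainedPatchHomCurvRegime3
  (alphaLJ alpha1LJ alphaB alpha1B alphaTrue_eq_lj alphaTrue_eq_bump
    hasDerivAt_alphaTrue_lj hasDerivAt_alphaTrue_bump hasDerivAt_betaTrue_lj hasDerivAt_betaTrue_bump)

/-! ## §1. `α′_LJ·ρ` as a function of `u = ρ⁻²` and its monotonicity -/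

/-- `K(u) = 80u⁵ − 224u⁸` (`= α′_LJ(ρ)·ρ` at `u = ρ⁻²`) has `K′(u) = 400u⁴ − 1792u⁷`. [folklore] -/
theorem hasDerivAt_KLJ (u : ℝ) : HasDerivAt (fun u : ℝ => 80 * u ^ 5 - 224 * u ^ 8) (400 * u ^ 4 - 1792 * u ^ 7) u := by
  have h := ((hasDerivAt_pow 5 u).const_mul 80).sub ((hasDerivAt_pow 8 u).const_mul 224)
  refine (h.congr_deriv ?_).congr_of_eventuallyEq (Filter.Eventually.of_forall fun x => rfl)
  push_cast; ring

/-- `K` is antitone on `[a, b]` once `112a³ ≥ 25` (`a ≥ 0`). [folklore] -/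
theorem KLJ_antitoneOn {a b : ℝ} (ha : 0 ≤ a) (h : 25 ≤ 112 * a ^ 3) : AntitoneOn (fun u : ℝ => 80 * u ^ 5 - 224 * u ^ 8) (Set.Icc a b) := by
  refine antitoneOn_of_deriv_nonpos (convex_Icc a b) (fun x _ => (hasDerivAt_KLJ x).continuousAt.continuousWithinAt)
    (fun x _ => (hasDerivAt_KLJ x).differentiableAt.differentiableWithinAt) ?_
  intro x hx
  rw [interior_Icc] at hx
  rw [(hasDerivAt_KLJ x).deriv]
  have hxpos : 0 ≤ x := ha.trans hx.1.le
  have h3 : a ^ 3 ≤ x ^ 3 := pow_le_pow_left₀ ha hx.1.le 3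
  have e : 400 * x ^ 4 - 1792 * x ^ 7 = -(16 * x ^ 4 * (112 * x ^ 3 - 25)) := by ring
  rw [e, neg_nonpos]
  have : 0 ≤ x ^ 4 := by positivity
  have : 0 ≤ 112 * x ^ 3 - 25 := by linarith
  positivity

/-- `α′_LJ(ρ)·ρ = K(ρ⁻²)` (`ρ ≠ 0`). [arithmetic] -/
theorem alpha1LJ_mul_eq_KLJ {ρ : ℝ} (hρ : ρ ≠ 0) : alpha1LJ ρ * ρ = (fun u : ℝ => 80 * u ^ 5 - 224 * u ^ 8) ((ρ ^ 2)⁻¹) := by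
  have p17 : (ρ⁻¹) ^ 17 * ρ = (ρ⁻¹) ^ 16 := by rw [pow_succ, mul_assoc, inv_mul_cancel₀ hρ, mul_one]
  have p11 : (ρ⁻¹) ^ 11 * ρ = (ρ⁻¹) ^ 10 := by rw [pow_succ, mul_assoc, inv_mul_cancel₀ hρ, mul_one]
  calc alpha1LJ ρ * ρ = -224 * ((ρ⁻¹) ^ 17 * ρ) + 80 * ((ρ⁻¹) ^ 11 * ρ) := by rw [alpha1LJ]; ring
    _ = (fun u : ℝ => 80 * u ^ 5 - 224 * u ^ 8) ((ρ ^ 2)⁻¹) := by rw [p17, p11]; simp only [inv_sq_pow]; ring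

/-- The thin endpoint `thin k` (`k > 0`) is `(√(k/SC))²`. [arithmetic] -/
theorem mem_thin_sqrt_sq {k : ℤ} (hk : 0 < k) : FI.mem (Real.sqrt ((k : ℝ) / SC) ^ 2) (thin k) := by
  rw [Real.sq_sqrt (div_nonneg (by exact_mod_cast hk.le) SC_pos.le)]
  exact mem_thin k

/-- ★ `alpha1LJHull` encloses `α′_LJ(ρ)·ρ` on the whole interval (`Q.lo > 0`, `ρ > 0`, `ρ² ∈ Q`). [folklore: `K` antitone in `u` for `q ≤ 41/25`] -/
theorem mem_alpha1LJHull {ρ : ℝ} (h0 : 0 < ρ) {Q A : FI} (hpos : 0 < Q.lo) (hq : FI.mem (ρ ^ 2) Q) (h : alpha1LJHull Q = some A) :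
    FI.mem (alpha1LJ ρ * ρ) A := by
  unfold alpha1LJHull at h
  cases h1 : ljTripleFI (thin Q.lo) with
  | none => rw [h1] at h; exact absurd h (by simp)
  | some t1 =>
  cases h2 : ljTripleFI (thin Q.hi) with
  | none => rw [h1, h2] at h; exact absurd h (by simp)
  | some t2 =>
  cases hn : ljTripleFI Q with
  | none => rw [h1, h2, hn] at h; exact absurd h (by simp)
  | some tn =>
  rw [h1, h2, hn] at h
  simp only at h
  -- real end points `q₁ ≤ ρ² ≤ q₂`
  set q1 : ℝ := (Q.lo : ℝ) / SC with hq1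
  set q2 : ℝ := (Q.hi : ℝ) / SC with hq2
  obtain ⟨hlo, hhi⟩ := endpoints_of_mem hq
  have hq1pos : 0 < q1 := div_pos (by exact_mod_cast hpos) SC_pos
  have hqpos : 0 < ρ ^ 2 := by positivity
  have hq2pos : 0 < q2 := hqpos.trans_le hhi
  have hhipos : 0 < Q.hi := by
    have : (0 : ℝ) < Q.hi := by rw [hq2] at hq2pos; exact (div_pos_iff_of_pos_right SC_pos).1 hq2pos
    exact_mod_cast this
  -- the three memberships
  have m1 : FI.mem ((fun u : ℝ => 80 * u ^ 5 - 224 * u ^ 8) q1⁻¹) t1.2.1 := by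
    have := (mem_ljTripleFI (mem_thin_sqrt_sq hpos) h1).2.1
    rwa [alpha1LJ_mul_eq_KLJ (Real.sqrt_pos.2 hq1pos).ne', Real.sq_sqrt hq1pos.le] at this
  have m2 : FI.mem ((fun u : ℝ => 80 * u ^ 5 - 224 * u ^ 8) q2⁻¹) t2.2.1 := by
    have := (mem_ljTripleFI (mem_thin_sqrt_sq hhipos) h2).2.1
    rwa [alpha1LJ_mul_eq_KLJ (Real.sqrt_pos.2 hq2pos).ne', Real.sq_sqrt hq2pos.le] at this
  have mn : FI.mem ((fun u : ℝ => 80 * u ^ 5 - 224 * u ^ 8) (ρ ^ 2)⁻¹) tn.2.1 := by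
    have := (mem_ljTripleFI hq hn).2.1
    rwa [alpha1LJ_mul_eq_KLJ h0.ne'] at this
  rw [alpha1LJ_mul_eq_KLJ h0.ne']
  split_ifs at h with hA
  · cases h
    -- `q₂ ≤ 41/25` ⟹ `K` antitone on `[q₂⁻¹, q₁⁻¹] ∋ (ρ²)⁻¹`
    have hq2le : q2 ≤ 41 / 25 := by
      have := le_of_le_qc (n := 164) (d := 100) (by norm_num) hA
      rw [hq2, div_le_iff₀ SC_pos]; linarith
    have hu1 : (ρ ^ 2)⁻¹ ≤ q1⁻¹ := by rw [inv_le_inv₀ hqpos hq1pos]; exact hlo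
    have hu2 : q2⁻¹ ≤ (ρ ^ 2)⁻¹ := by rw [inv_le_inv₀ hq2pos hqpos]; exact hhi
    have hkey : 25 ≤ 112 * q2⁻¹ ^ 3 := by
      rw [inv_pow, le_mul_inv_iff₀ (by positivity)]
      nlinarith [hq2pos, hq2le, mul_pos hq2pos hq2pos, mul_pos (mul_pos hq2pos hq2pos) hq2pos]
    have hm := KLJ_antitoneOn (a := q2⁻¹) (b := q1⁻¹) (inv_pos.2 hq2pos).le hkey
    have k1 : (fun u : ℝ => 80 * u ^ 5 - 224 * u ^ 8) q1⁻¹ ≤ (fun u : ℝ => 80 * u ^ 5 - 224 * u ^ 8) (ρ ^ 2)⁻¹ :=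
      hm ⟨hu2, hu1⟩ ⟨hu2.trans hu1, le_rfl⟩ hu1
    have k2 : (fun u : ℝ => 80 * u ^ 5 - 224 * u ^ 8) (ρ ^ 2)⁻¹ ≤ (fun u : ℝ => 80 * u ^ 5 - 224 * u ^ 8) q2⁻¹ :=
      hm ⟨le_rfl, hu2.trans hu1⟩ ⟨hu2, hu1⟩ hu2
    exact ⟨m1.1.trans (mul_le_mul_of_nonneg_right k1 SC_pos.le), (mul_le_mul_of_nonneg_right k2 SC_pos.le).trans m2.2⟩
  · cases h
    exact mn

/-! ## §2. ★ A Lipschitz-class label lies in one open regime; its classed coefficients and the derivative chain -/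

/-- `Q.hi < qc 64 25` and `ρ² ∈ Q` ⟹ `ρ < 8/5`. [arithmetic] -/
theorem lt_eightFifths_of_hi {ρ : ℝ} (h0 : 0 ≤ ρ) {Q : FI} (hq : FI.mem (ρ ^ 2) Q) (hbump : Q.hi < qc 64 25) : ρ < 8 / 5 := by
  have hh : ρ ^ 2 * SC ≤ Q.hi := hq.2
  have hlt' : (Q.hi : ℝ) + 1 ≤ qc 64 25 := by exact_mod_cast hbump
  have hqc : ((qc 64 25 : ℤ) : ℝ) ≤ 64 * SC / 25 := le_of_le_qc (n := 64) (d := 25) (by norm_num) le_rfl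
  have : ρ ^ 2 * SC < 64 * SC / 25 := by linarith
  have : ρ ^ 2 < 64 / 25 := by
    rw [lt_div_iff₀ (by norm_num : (0:ℝ) < 25)]
    have := SC_pos
    nlinarith
  nlinarith

/-- `qc 65 25 ≤ Q.lo`, `Q.hi < 9·SC` and `ρ² ∈ Q` ⟹ `8/5 < ρ < 3` (`ρ ≥ 0`). [arithmetic] -/
theorem lj_of_lo_hi {ρ : ℝ} (h0 : 0 ≤ ρ) {Q : FI} (hq : FI.mem (ρ ^ 2) Q) (hlj : qc 65 25 ≤ Q.lo) (h9 : Q.hi < 9 * (SC : ℤ)) :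
    8 / 5 < ρ ∧ ρ < 3 := by
  constructor
  · have h1 := lt_of_qc_le (n := 65) (d := 25) (by norm_num) hlj
    have hh : (Q.lo : ℝ) ≤ ρ ^ 2 * SC := hq.1
    have hS : (100 : ℝ) ≤ SC := by norm_num [SC]
    have : 64 / 25 * SC < ρ ^ 2 * SC := by push_cast at h1; nlinarith
    have : 64 / 25 < ρ ^ 2 := lt_of_mul_lt_mul_right this SC_pos.le
    nlinarith
  · have h9' : (Q.hi : ℝ) < 9 * SC := by exact_mod_cast h9
    have hh : ρ ^ 2 * SC ≤ Q.hi := hq.2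
    have : ρ ^ 2 < 9 := by nlinarith [SC_pos]
    nlinarith

/-- ★★ **A LIPSCHITZ-CLASS LABEL** (`coefL Q = some co`, `co.lip = true`, `ρ > 0`, `ρ² ∈ Q`): `ρ` lies in the OPEN bump or Lennard-Jones regime (hence
off the junction radii), `α(ρ) ∈ co.al`, `β(ρ) ∈ co.be`, and there is `a₁ ∈ co.a1` with `HasDerivAt α (a₁·ρ) ρ` and `HasDerivAt β (α(ρ)·ρ) ρ` for the
TRUE coefficient functions `α = (W″ − W′/r)/r²`, `β = W′/r`. [folklore chaining: `mem_coeffT`, `mem_alpha1LJHull`, `…HomCurvRegime3`] -/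
theorem coefL_lip {ρ : ℝ} (h0 : 0 < ρ) {Q : FI} (hq : FI.mem (ρ ^ 2) Q) {co : CoefL} (h : coefL Q = some co) (hl : co.lip = true) :
    ((0 < ρ ∧ ρ < 8 / 5) ∨ (8 / 5 < ρ ∧ ρ < 3)) ∧ ρ ∉ junctions ∧
    FI.mem ((deriv (deriv (effPot w₄₅ ω₄ (3 / 400))) ρ - deriv (effPot w₄₅ ω₄ (3 / 400)) ρ / ρ) / ρ ^ 2) co.al ∧
    FI.mem (deriv (effPot w₄₅ ω₄ (3 / 400)) ρ / ρ) co.be ∧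
    (∃ a₁ : ℝ, FI.mem a₁ co.a1 ∧
      HasDerivAt (fun s => (deriv (deriv (effPot w₄₅ ω₄ (3 / 400))) s - deriv (effPot w₄₅ ω₄ (3 / 400)) s / s) / s ^ 2) (a₁ * ρ) ρ) ∧
    HasDerivAt (fun s => deriv (effPot w₄₅ ω₄ (3 / 400)) s / s)
      ((deriv (deriv (effPot w₄₅ ω₄ (3 / 400))) ρ - deriv (effPot w₄₅ ω₄ (3 / 400)) ρ / ρ) / ρ ^ 2 * ρ) ρ := by
  -- regime first (every `lip = true` branch of `coefL` sits inside one open regime), then the coefficient memberships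
  have hreg : (Q.hi < qc 64 25 ∧ ∃ a1r u, alpha1LJHull Q = some a1r ∧ FI.divPos (FI.ofInt 1) Q = some u ∧
      co.a1 = (a1r.sub (k75 (bumpWT1FI (wFI (rhoFI Q))))).mul u) ∨
      (qc 65 25 ≤ Q.lo ∧ Q.hi < 9 * (SC : ℤ) ∧ ∃ a1r u, alpha1LJHull Q = some a1r ∧ FI.divPos (FI.ofInt 1) Q = some u ∧ co.a1 = a1r.mul u) := by
    unfold coefL at h
    split at h
    · cases h
    · rename_i ab hT
      by_cases hlo : Q.lo ≤ 0
      · rw [if_pos hlo] at h; cases h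
      rw [if_neg hlo] at h
      by_cases hb : Q.hi < qc 64 25
      · rw [if_pos hb] at h
        left
        refine ⟨hb, ?_⟩
        split at h
        · rename_i a1r u ha hu
          cases h
          exact ⟨a1r, u, ha, hu, rfl⟩
        · cases h; simp at hl
      · rw [if_neg hb] at h
        by_cases hl' : qc 65 25 ≤ Q.lo ∧ Q.hi < 9 * (SC : ℤ)
        · rw [if_pos hl'] at h
          right
          refine ⟨hl'.1, hl'.2, ?_⟩
          split at h
          · rename_i a1r u ha hu
            cases h
            exact ⟨a1r, u, ha, hu, rfl⟩
          · cases h; simp at hl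
        · rw [if_neg hl'] at h
          cases h; simp at hl
  have hlo : 0 < Q.lo := by
    unfold coefL at h
    split at h
    · cases h
    · by_contra hle
      rw [if_pos (not_lt.1 hle)] at h
      cases h
  have hJ_of : ((0 < ρ ∧ ρ < 8 / 5) ∨ (8 / 5 < ρ ∧ ρ < 3)) → ρ ∉ junctions := by
    intro hr hmem
    have h1 : ρ = 8 / 5 ∨ ρ = 3 ∨ ρ = 9 / 2 := by simpa [junctions] using hmem
    rcases hr with ⟨_, h2⟩ | ⟨h2, h3⟩ <;> rcases h1 with e | e | e <;> linarith
  have hu_mem : ∀ u, FI.divPos (FI.ofInt 1) Q = some u → FI.mem ((ρ ^ 2)⁻¹) u := fun u hu => by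
    have := FI.mem_divPos hu (by simpa using FI.mem_ofInt 1) hq
    simpa [one_div] using this
  rcases hreg with ⟨hb, a1r, u, ha, hu, hco⟩ | ⟨hl1, hl2, a1r, u, ha, hu, hco⟩
  · -- bump regime
    have hρ : 0 < ρ ∧ ρ < 8 / 5 := ⟨h0, lt_eightFifths_of_hi h0.le hq hb⟩
    have hreg' : (0 < ρ ∧ ρ < 8 / 5) ∨ (8 / 5 < ρ ∧ ρ < 3) := Or.inl hρ
    have hJ := hJ_of hreg'
    obtain ⟨mal, mbe⟩ := mem_coefL h0 hJ hq h
    refine ⟨hreg', hJ, mal, mbe, ⟨alpha1B ρ / ρ, ?_, ?_⟩, ?_⟩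
    · rw [hco]
      have m1 : FI.mem (alpha1LJ ρ * ρ) a1r := mem_alpha1LJHull h0 hlo hq ha
      have mw : FI.mem (5 * ρ / 4) (wFI (rhoFI Q)) := mem_wFI (mem_rhoFI h0.le hq)
      have m2 : FI.mem (75 / 2048 * (5 * ρ / 4 * Summit.AtomisticToContinuum.Crystallization.Theorems.FrustratedLawDichotomyStrainedPatchHomCurvRegime3.bumpT1 (5 * ρ / 4)))
          (k75 (bumpWT1FI (wFI (rhoFI Q)))) := mem_k75 (mem_bumpWT1FI mw)
      have m3 := FI.mem_mul (FI.mem_sub m1 m2) (hu_mem u hu)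
      have e : (alpha1LJ ρ * ρ - 75 / 2048 * (5 * ρ / 4 *
          Summit.AtomisticToContinuum.Crystallization.Theorems.FrustratedLawDichotomyStrainedPatchHomCurvRegime3.bumpT1 (5 * ρ / 4))) * (ρ ^ 2)⁻¹ =
          alpha1B ρ / ρ := by
        rw [alpha1B]; field_simp
      rw [← e]; exact m3
    · have e : alpha1B ρ / ρ * ρ = alpha1B ρ := by field_simp
      rw [e]; exact hasDerivAt_alphaTrue_bump hρ.1 hρ.2
    · rw [alphaTrue_eq_bump hρ.1 hρ.2]; exact hasDerivAt_betaTrue_bump hρ.1 hρ.2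
  · -- Lennard-Jones regime
    have hρ : 8 / 5 < ρ ∧ ρ < 3 := lj_of_lo_hi h0.le hq hl1 hl2
    have hreg' : (0 < ρ ∧ ρ < 8 / 5) ∨ (8 / 5 < ρ ∧ ρ < 3) := Or.inr hρ
    have hJ := hJ_of hreg'
    obtain ⟨mal, mbe⟩ := mem_coefL h0 hJ hq h
    refine ⟨hreg', hJ, mal, mbe, ⟨alpha1LJ ρ / ρ, ?_, ?_⟩, ?_⟩
    · rw [hco]
      have m1 : FI.mem (alpha1LJ ρ * ρ) a1r := mem_alpha1LJHull h0 hlo hq ha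
      have m3 := FI.mem_mul m1 (hu_mem u hu)
      have e : alpha1LJ ρ * ρ * (ρ ^ 2)⁻¹ = alpha1LJ ρ / ρ := by field_simp
      rw [← e]; exact m3
    · have e : alpha1LJ ρ / ρ * ρ = alpha1LJ ρ := by field_simp
      rw [e]; exact hasDerivAt_alphaTrue_lj hρ.1 hρ.2
    · rw [alphaTrue_eq_lj hρ.1 hρ.2]; exact hasDerivAt_betaTrue_lj hρ.1 hρ.2

/-! ## §3. ★ The `P`/`R` tables of the record -/

/-- ★ **`R.pt` and `R.rt` enclose `P_kl = a₁ζ_kζ_l + αν_kl` and `R_kl = αν_kl`** (symmetric storage `sIx`; `k, l < top`), given the memberships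
`a₁ ∈ R.co.a1`, `α ∈ R.co.al` and the record memberships of `ζ`, `ν` (`…SoundL.mem_mkDRec`). [folklore chaining] -/
theorem mem_pt_rt {top : ℕ} (htop : top ≤ 9) {E : Fin 3 × Fin 3 → FI} {qI : Fin 3 → FI} {R : DRec} (h : mkDRec top E qI = some R)
    {a₁ α : ℝ} (ha : FI.mem a₁ R.co.a1) (hα : FI.mem α R.co.al) {ζ : ℕ → ℝ} {ν : ℕ → ℕ → ℝ}
    (hζ : ∀ k, k < top → FI.mem (ζ k) (R.z k)) (hν : ∀ k l, k < top → l < top → FI.mem (ν k l) (R.n k l))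
    (hνs : ∀ k l, ν k l = ν l k) {k l : ℕ} (hk : k < top) (hl : l < top) :
    FI.mem (a₁ * (ζ k * ζ l) + α * ν k l) (R.pt.getD (sIx k l) fi0) ∧ FI.mem (α * ν k l) (R.rt.getD (sIx k l) fi0) := by
  -- WLOG `k ≤ l` (both sides are symmetric)
  wlog hkl : k ≤ l generalizing k l
  · have := this hl hk (not_le.1 hkl).le
    have e1 : sIx k l = sIx l k := by unfold sIx; rw [if_neg hkl, if_pos (not_le.1 hkl).le]
    rw [e1, show ζ k * ζ l = ζ l * ζ k by ring, hνs k l]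
    exact this
  have hsIx : sIx k l = 9 * k + l := by unfold sIx; rw [if_pos hkl]
  -- unpack the record as in `mem_mkDRec`
  unfold mkDRec at h
  extract_lets qt y at h
  split at h
  · exact absurd h (by simp)
  rename_i dy gd ze nu gz xo co hco
  extract_lets pt rt at h
  simp only [Option.some.injEq] at h
  subst h
  have e1 : (9 * k + l) / 9 = k := by omega
  have e2 : (9 * k + l) % 9 = l := by omega
  have hz : ∀ a, a < top → FI.mem (ζ a) (gz a) := fun a hat => hζ a hat
  have hn : FI.mem (ν k l) (nu.getD (9 * k + l) fi0) := by
    have := hν k l hk hl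
    simp only [DRec.n] at this
    rwa [hsIx] at this
  rw [hsIx]
  constructor
  · show FI.mem _ ((Array.ofFn fun n : Fin 81 =>
        if n.val / 9 ≤ n.val % 9 ∧ n.val % 9 < top then (co.a1.mul ((gz (n.val / 9)).mul (gz (n.val % 9)))).add (co.al.mul (nu.getD n.val fi0))
        else fi0).getD (9 * k + l) fi0)
    rw [getD_ofFn_lt _ _ (by omega : 9 * k + l < 81)]
    simp only [e1, e2, if_pos (And.intro hkl hl)]
    exact FI.mem_add (FI.mem_mul ha (FI.mem_mul (hz k hk) (hz l hl))) (FI.mem_mul hα hn)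
  · show FI.mem _ ((Array.ofFn fun n : Fin 81 =>
        if n.val / 9 ≤ n.val % 9 ∧ n.val % 9 < top then co.al.mul (nu.getD n.val fi0) else fi0).getD (9 * k + l) fi0)
    rw [getD_ofFn_lt _ _ (by omega : 9 * k + l < 81)]
    simp only [e1, e2, if_pos (And.intro hkl hl)]
    exact FI.mem_mul hα hn

/-! ## §4. ★ `omg` encloses the real `ω_abm = Σ_c [(∂_b y)_c (∂_m∂_a y)_c + (∂_a y)_c (∂_m∂_b y)_c + (∂_m y)_c (∂_a∂_b y)_c]` (written out; `y = Vq`) -/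

/-- `ddyR` vanishes unless the pair mixes one `U`- and one `ξ`-coordinate. [formal bookkeeping] -/
theorem ddyR_eq_zero {k l : ℕ} (h : (k < 6 ∧ l < 6) ∨ (6 ≤ k ∧ 6 ≤ l)) (cc : Fin 3) : ddyR k l cc = 0 := by
  unfold ddyR
  have h1 : ¬ (k < 6 ∧ 6 ≤ l ∧ l < 9) := by omega
  have h2 : ¬ (l < 6 ∧ 6 ≤ k ∧ k < 9) := by omega
  rw [if_neg h1, if_neg h2]

/-- `ω_abm = 0` on the unmixed triples (`omgZero`). [formal bookkeeping] -/
theorem omgR_eq_zero (V : E3 →L[ℝ] E3) (q : E3) {a b m : ℕ} (h : omgZero a b m = true) :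
    (∑ cc : Fin 3, (dyR V q b cc * ddyR m a cc + dyR V q a cc * ddyR m b cc + dyR V q m cc * ddyR a b cc)) = 0 := by
  have h' : (a < 6 ∧ b < 6 ∧ m < 6) ∨ (6 ≤ a ∧ 6 ≤ b ∧ 6 ≤ m) := by simpa [omgZero] using h
  refine Finset.sum_eq_zero fun cc _ => ?_
  rw [ddyR_eq_zero (k := m) (l := a) (by omega), ddyR_eq_zero (k := m) (l := b) (by omega), ddyR_eq_zero (k := a) (l := b) (by omega)]
  ring

/-- ★ **`omg R a b m` encloses `ω_abm`** given the first-derivative memberships of the record (`a, b, m < top ≤ 9`). [folklore chaining] -/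
theorem mem_omg {top : ℕ} (htop : top ≤ 9) {R : DRec} (V : E3 →L[ℝ] E3) (q : E3)
    (hd : ∀ a, a < top → ∀ cc : Fin 3, FI.mem (dyR V q a cc) (R.d a cc.val)) {a b m : ℕ} (ha : a < top) (hb : b < top) (hm : m < top) :
    FI.mem (∑ cc : Fin 3, (dyR V q b cc * ddyR m a cc + dyR V q a cc * ddyR m b cc + dyR V q m cc * ddyR a b cc)) (omg R a b m) := by
  have h9a : a < 9 := by omega
  have h9b : b < 9 := by omega
  have h9m : m < 9 := by omega
  -- one summand
  have term : ∀ (cc : Fin 3), FI.mem (dyR V q b cc * ddyR m a cc + dyR V q a cc * ddyR m b cc + dyR V q m cc * ddyR a b cc)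
      ((((R.d b cc.val).mulInt (d2 m a cc)).add ((R.d a cc.val).mulInt (d2 m b cc))).add ((R.d m cc.val).mulInt (d2 a b cc))) := by
    intro cc
    rw [← d2_cast h9m h9a cc, ← d2_cast h9m h9b cc, ← d2_cast h9a h9b cc]
    exact FI.mem_add (FI.mem_add (FI.mem_mulInt (hd b hb cc) _) (FI.mem_mulInt (hd a ha cc) _)) (FI.mem_mulInt (hd m hm cc) _)
  -- the three-step fold, accumulator generalised
  have step : ∀ (acc : FI) (x : ℝ), FI.mem x acc → ∀ (cc : Fin 3),
      FI.mem (x + (dyR V q b cc * ddyR m a cc + dyR V q a cc * ddyR m b cc + dyR V q m cc * ddyR a b cc))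
        (((acc.add ((R.d b cc.val).mulInt (d2 m a cc))).add ((R.d a cc.val).mulInt (d2 m b cc))).add ((R.d m cc.val).mulInt (d2 a b cc))) := by
    intro acc x hx cc
    have := term cc
    have e : x + (dyR V q b cc * ddyR m a cc + dyR V q a cc * ddyR m b cc + dyR V q m cc * ddyR a b cc) =
        ((x + dyR V q b cc * ((d2 m a cc : ℤ) : ℝ)) + dyR V q a cc * ((d2 m b cc : ℤ) : ℝ)) + dyR V q m cc * ((d2 a b cc : ℤ) : ℝ) := by
      rw [d2_cast h9m h9a cc, d2_cast h9m h9b cc, d2_cast h9a h9b cc]; ring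
    rw [e]
    exact FI.mem_add (FI.mem_add (FI.mem_add hx (FI.mem_mulInt (hd b hb cc) _)) (FI.mem_mulInt (hd a ha cc) _)) (FI.mem_mulInt (hd m hm cc) _)
  unfold omg
  rw [Fin.sum_univ_three]
  have h0 := step fi0 0 mem_fi0 0
  have h1 := step _ _ h0 1
  have h2 := step _ _ h1 2
  rw [zero_add] at h2
  simpa [List.range, List.range.loop, List.foldl] using h2

/-! ## §5. ★★ `thirdOf` encloses the real third derivative `T_abm` -/

/-- ★★ **THE THIRD-DERIVATIVE TABLE**: for `a, b, m < top` the entry `thirdOf R a b m` encloses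
`T_abm = ζ_m (a₁ ζ_a ζ_b + α ν_ab) + α ν_am ζ_b + α ν_bm ζ_a + β ω_abm` — the `s`-derivative coefficient of the Hessian entry `α ζ_a ζ_b + β ν_ab` along the
segment (`a₁ = α′/ρ`; `β′ = αρ`; `ζ′ = Σ ν δ`, `ν′ = Σ ω δ`, see part P). [folklore chaining] -/
theorem mem_thirdOf {top : ℕ} (htop : top ≤ 9) {E : Fin 3 × Fin 3 → FI} {qI : Fin 3 → FI} {R : DRec} (h : mkDRec top E qI = some R)
    (V : E3 →L[ℝ] E3) (q : E3) (hE : ∀ ab : Fin 3 × Fin 3, FI.mem ((V (EuclideanSpace.single ab.2 (1 : ℝ))) ab.1) (E ab))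
    (hq : ∀ c, FI.mem (q c) (qI c)) {a₁ α β : ℝ} (ha1 : FI.mem a₁ R.co.a1) (hα : FI.mem α R.co.al) (hβ : FI.mem β R.co.be)
    {a b m : ℕ} (ha : a < top) (hb : b < top) (hm : m < top) :
    FI.mem (zetaN V q m * (a₁ * (zetaN V q a * zetaN V q b) + α * nuR V q a b) + α * nuR V q a m * zetaN V q b +
        α * nuR V q b m * zetaN V q a +
        β * (∑ cc : Fin 3, (dyR V q b cc * ddyR m a cc + dyR V q a cc * ddyR m b cc + dyR V q m cc * ddyR a b cc))) (thirdOf R a b m) := by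
  obtain ⟨_, hd, hζ, hν⟩ := mem_mkDRec htop h V q hE hq
  have hνs : ∀ k l, nuR V q k l = nuR V q l k := nuR_symm V q
  have hP := (mem_pt_rt htop h ha1 hα hζ hν hνs ha hb).1
  have hRam := (mem_pt_rt htop h ha1 hα hζ hν hνs ha hm).2
  have hRbm := (mem_pt_rt htop h ha1 hα hζ hν hνs hb hm).2
  have hbase : FI.mem (zetaN V q m * (a₁ * (zetaN V q a * zetaN V q b) + α * nuR V q a b) + α * nuR V q a m * zetaN V q b +
      α * nuR V q b m * zetaN V q a)
      ((((R.z m).mul (R.pt.getD (sIx a b) fi0)).add ((R.rt.getD (sIx a m) fi0).mul (R.z b))).add ((R.rt.getD (sIx b m) fi0).mul (R.z a))) :=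
    FI.mem_add (FI.mem_add (FI.mem_mul (hζ m hm) hP) (FI.mem_mul hRam (hζ b hb))) (FI.mem_mul hRbm (hζ a ha))
  unfold thirdOf
  by_cases hz : omgZero a b m = true
  · simp only [hz, ite_true]
    rw [omgR_eq_zero V q hz, mul_zero, add_zero]
    exact hbase
  · simp only [hz]
    exact FI.mem_add hbase (FI.mem_mul hβ (mem_omg htop V q hd ha hb hm))

end Summit.AtomisticToContinuum.Crystallization.Theorems.FrustratedLawDichotomyStrainedPatchHomValueT2Kit
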